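import Summits.QuantumFields.YangMills.Theorems.ToronValleyVolumeLojasiewiczLocaliseQuaternion
import HarnessLib

/-!
# LINEAR stability of the twisted commutation relations in the unit quaternions
# (helper file for the crux `TwistEaterVolume.QuadraticGrowth`, item stmt-QuantumFields-24320, LINE g15-A of ym-idea-4)

The zero set of the TWISTED periodic deficit is rigid: in the comb gauge it is the set of quadruples `(c; w₀,w₁,w₂)` with `[w_i,w_j] = 1` and
`c w_k c⁻¹ = ε_k w_k`, `ε_k = −1` for the twisted directions (at least one).  This file proves the `L`-independent LINEAR stability of these relations
in the quaternion model: if unit quaternions `a, u_k` satisfy `‖u_i u_j − u_j u_i‖ ≤ η`, `‖a u_k + u_k a‖ ≤ η` (twisted `k`) and `‖a u_k − u_k a‖ ≤ η`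
(untwisted `k`), and some direction is twisted, then there is an EXACT solution `(a'; u'_k)` of the relations within `4η` of `(a; u_k)` (every member).
* `norm_sq_anticomm_eq` — `‖au + ua‖² = 4((s_a s_u − v_a·v_u)² + |s_a v_u + s_u v_a|²)`; with unit norms this is `4((v_a·v_u)² + s_a² + s_u² − s_a²s_u²)`,
  so an almost-ANTIcommuting unit pair has both real parts and the dot product of the imaginary parts `≤ η/2` (`re_sq_le_of_anticomm`, …);
* ★ `exists_twisted_solution_near` — the stability statement (witness: `a' = (0, n_c)`, `u'_k = (0, ±n₀)` for twisted `k`, `u'_k = ±1` for untwisted `k`,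
  with `n₀` the axis of a twisted member and `n_c ⊥ n₀` the normalised projection of `Im a`).
HONEST FRAMING: elementary algebra in `ℍ`; nothing about the lattice or Yang–Mills is proved here.  THEOREMS ONLY (no definition, no `sorry`).
-/

set_option autoImplicit false

noncomputable section

open scoped Quaternion

namespace Summit.QuantumFields.YangMills.Theorems.TwistEaterVolume.Quadratic

open Summit.QuantumFields.YangMills.Theorems.ToronValleyVolume.Lojasiewicz

/-! ## §1 The anticommutator identity -/

/-- `‖au + ua‖² = 4((s_a s_u − v_a·v_u)² + |s_a v_u + s_u v_a|²)`. [folklore] -/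
theorem norm_sq_anticomm_eq (a u : ℍ) :
    ‖a * u + u * a‖ ^ 2 =
      4 * ((a.re * u.re - (a.imI * u.imI + a.imJ * u.imJ + a.imK * u.imK)) ^ 2 +
        ((a.re * u.imI + u.re * a.imI) ^ 2 + (a.re * u.imJ + u.re * a.imJ) ^ 2 + (a.re * u.imK + u.re * a.imK) ^ 2)) := by
  rw [sq, ← Quaternion.normSq_eq_norm_mul_self, Quaternion.normSq_def']
  simp only [Quaternion.re_add, Quaternion.imI_add, Quaternion.imJ_add, Quaternion.imK_add, Quaternion.re_mul, Quaternion.imI_mul,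
    Quaternion.imJ_mul, Quaternion.imK_mul]
  ring

/-- For UNIT quaternions: `‖au + ua‖² = 4((v_a·v_u)² + s_a² + s_u² − s_a² s_u²)`. [folklore] -/
theorem norm_sq_anticomm_eq_of_unit {a u : ℍ} (ha : ‖a‖ = 1) (hu : ‖u‖ = 1) :
    ‖a * u + u * a‖ ^ 2 =
      4 * ((a.imI * u.imI + a.imJ * u.imJ + a.imK * u.imK) ^ 2 + a.re ^ 2 + u.re ^ 2 - a.re ^ 2 * u.re ^ 2) := by
  have h1 : a.re ^ 2 + (a.imI * a.imI + a.imJ * a.imJ + a.imK * a.imK) = 1 := by rw [← norm_sq_eq_re_sq_add_imDot, ha, one_pow]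
  have h2 : u.re ^ 2 + (u.imI * u.imI + u.imJ * u.imJ + u.imK * u.imK) = 1 := by rw [← norm_sq_eq_re_sq_add_imDot, hu, one_pow]
  rw [norm_sq_anticomm_eq]
  nlinarith [h1, h2]

/-- An almost-anticommuting unit pair: `s_a² ≤ ‖au+ua‖²/4`, `s_u² ≤ ‖au+ua‖²/4`, `(v_a·v_u)² ≤ ‖au+ua‖²/4`. [folklore] -/
theorem sq_le_of_anticomm {a u : ℍ} (ha : ‖a‖ = 1) (hu : ‖u‖ = 1) {η : ℝ} (h : ‖a * u + u * a‖ ≤ η) :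
    a.re ^ 2 ≤ η ^ 2 / 4 ∧ u.re ^ 2 ≤ η ^ 2 / 4 ∧ (a.imI * u.imI + a.imJ * u.imJ + a.imK * u.imK) ^ 2 ≤ η ^ 2 / 4 := by
  have hsq : ‖a * u + u * a‖ ^ 2 ≤ η ^ 2 := pow_le_pow_left₀ (norm_nonneg _) h 2
  rw [norm_sq_anticomm_eq_of_unit ha hu] at hsq
  have ha1 : a.re ^ 2 ≤ 1 := by
    have := norm_sq_eq_re_sq_add_imDot a; rw [ha, one_pow] at this; nlinarith [imDot_self_nonneg a]
  have hu1 : u.re ^ 2 ≤ 1 := by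
    have := norm_sq_eq_re_sq_add_imDot u; rw [hu, one_pow] at this; nlinarith [imDot_self_nonneg u]
  have hprod : a.re ^ 2 * u.re ^ 2 ≤ a.re ^ 2 := by nlinarith [sq_nonneg a.re]
  have hprod' : a.re ^ 2 * u.re ^ 2 ≤ u.re ^ 2 := by nlinarith [sq_nonneg u.re]
  refine ⟨by nlinarith [sq_nonneg (a.imI * u.imI + a.imJ * u.imJ + a.imK * u.imK), sq_nonneg u.re], by nlinarith [sq_nonneg (a.imI * u.imI + a.imJ * u.imJ + a.imK * u.imK), sq_nonneg a.re], ?_⟩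
  nlinarith [sq_nonneg a.re, sq_nonneg u.re]

/-- The commutator bound as a cross-product bound: `|v_a|²|v_u|² − (v_a·v_u)² ≤ ‖au − ua‖²/4`. [folklore] -/
theorem cross_sq_le_of_comm (a u : ℍ) {η : ℝ} (h : ‖a * u - u * a‖ ≤ η) :
    (a.imI * a.imI + a.imJ * a.imJ + a.imK * a.imK) * (u.imI * u.imI + u.imJ * u.imJ + u.imK * u.imK) -
      (a.imI * u.imI + a.imJ * u.imJ + a.imK * u.imK) ^ 2 ≤ η ^ 2 / 4 := by
  have hsq : ‖a * u - u * a‖ ^ 2 ≤ η ^ 2 := pow_le_pow_left₀ (norm_nonneg _) h 2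
  rw [normSq_comm_eq] at hsq
  linarith

/-- Lagrange's identity in components. [folklore] -/
theorem lagrange₃ (x₁ x₂ x₃ y₁ y₂ y₃ : ℝ) :
    (x₁ * x₁ + x₂ * x₂ + x₃ * x₃) * (y₁ * y₁ + y₂ * y₂ + y₃ * y₃) - (x₁ * y₁ + x₂ * y₂ + x₃ * y₃) ^ 2 =
      (x₂ * y₃ - x₃ * y₂) ^ 2 + (x₃ * y₁ - x₁ * y₃) ^ 2 + (x₁ * y₂ - x₂ * y₁) ^ 2 := by
  ring

/-! ## §2 Pure-imaginary and real witnesses -/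

/-- Two pure imaginary quaternions with orthogonal imaginary parts anticommute. [folklore] -/
theorem pure_mul_pure_eq_neg {x y : ℍ} (hx : x.re = 0) (hy : y.re = 0) (h : x.imI * y.imI + x.imJ * y.imJ + x.imK * y.imK = 0) :
    x * y = -(y * x) := by
  ext <;> simp [hx, hy] <;> linarith

/-- A real quaternion is central. [folklore] -/
theorem mul_comm_of_im_zero {x : ℍ} (y : ℍ) (h1 : x.imI = 0) (h2 : x.imJ = 0) (h3 : x.imK = 0) : x * y = y * x := by
  ext <;> simp [h1, h2, h3] <;> ring

/-- Two quaternions whose imaginary parts are both multiples of one vector commute (component form). [folklore] -/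
theorem mul_comm_of_parallel {x y : ℍ} {n₁ n₂ n₃ s t : ℝ} (hx1 : x.imI = s * n₁) (hx2 : x.imJ = s * n₂) (hx3 : x.imK = s * n₃)
    (hy1 : y.imI = t * n₁) (hy2 : y.imJ = t * n₂) (hy3 : y.imK = t * n₃) : x * y = y * x := by
  ext <;> simp [hx1, hx2, hx3, hy1, hy2, hy3] <;> ring

/-- Unit norm from components: `re² + |Im|² = 1 ⇒ ‖y‖ = 1`. [folklore] -/
theorem norm_eq_one_of_components {y : ℍ} (h : y.re ^ 2 + (y.imI * y.imI + y.imJ * y.imJ + y.imK * y.imK) = 1) : ‖y‖ = 1 := by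
  have h1 : ‖y‖ ^ 2 = 1 := by rw [norm_sq_eq_re_sq_add_imDot]; exact h
  have h0 : 0 ≤ ‖y‖ := norm_nonneg _
  nlinarith [h1]


/-! ## §3 ★ Linear stability of the twisted relations -/

/-- Auxiliary real arithmetic for the twisted members: from `s² ≤ η²/4`, `D = 1 − s²`, `D − τ² ≤ 4η²/15`, `τ² ≤ D`, `η ≤ 1/2`:
`2 − 2|τ| ≤ 16η²`. [folklore] -/
theorem twisted_member_arith {s D τ η : ℝ} (hs : s ^ 2 ≤ η ^ 2 / 4) (hD : s ^ 2 + D = 1)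
    (hperp : D - τ ^ 2 ≤ 4 * η ^ 2 / 15) (hτD : τ ^ 2 ≤ D) : 2 - 2 * |τ| ≤ 16 * η ^ 2 := by
  have hτ1 : |τ| ≤ 1 := by
    have : τ ^ 2 ≤ 1 := by nlinarith
    rw [← sq_le_one_iff_abs_le_one]; exact this
  have hτsq : 1 - 7 * η ^ 2 / 12 ≤ τ ^ 2 := by nlinarith
  have h1 : 1 - |τ| ≤ 1 - τ ^ 2 := by
    rw [← sq_abs]; nlinarith [abs_nonneg τ]
  nlinarith [abs_nonneg τ]

/-- Auxiliary real arithmetic for the untwisted members: `(s − σ)² + D ≤ 2D` when `σ = sign s` and `s² + D = 1`. [folklore] -/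
theorem untwisted_member_arith {s D : ℝ} (hD : s ^ 2 + D = 1) (hD0 : 0 ≤ D) :
    (s - (if 0 ≤ s then (1:ℝ) else -1)) ^ 2 + D ≤ 2 * D := by
  have hs1 : |s| ≤ 1 := by rw [← sq_le_one_iff_abs_le_one]; nlinarith
  have e1 : (s - (if 0 ≤ s then (1:ℝ) else -1)) ^ 2 = (1 - |s|) ^ 2 := by
    split_ifs with h
    · rw [abs_of_nonneg h]; ring
    · rw [abs_of_neg (lt_of_not_ge h)]; ring
  rw [e1]
  have hDs : D = 1 - |s| ^ 2 := by rw [sq_abs]; linarith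
  have h3 : 1 - |s| ≤ D := by rw [hDs]; nlinarith [abs_nonneg s]
  have h4 : 0 ≤ 1 - |s| := by linarith
  have h5 : D ≤ 1 := by nlinarith [abs_nonneg s]
  nlinarith

/-- Normalising a non-zero vector of `ℝ³`: `x = r·n` with `r > 0`, `r² = |x|²`, `|n| = 1`. [folklore] -/
theorem exists_unit_of_pos {x₁ x₂ x₃ : ℝ} (h : 0 < x₁ * x₁ + x₂ * x₂ + x₃ * x₃) :
    ∃ r n₁ n₂ n₃ : ℝ, 0 < r ∧ r ^ 2 = x₁ * x₁ + x₂ * x₂ + x₃ * x₃ ∧ x₁ = r * n₁ ∧ x₂ = r * n₂ ∧ x₃ = r * n₃ ∧ n₁ ^ 2 + n₂ ^ 2 + n₃ ^ 2 = 1 := by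
  have hs : Real.sqrt (x₁ * x₁ + x₂ * x₂ + x₃ * x₃) ≠ 0 := (Real.sqrt_pos.2 h).ne'
  have hr : Real.sqrt (x₁ * x₁ + x₂ * x₂ + x₃ * x₃) ^ 2 = x₁ * x₁ + x₂ * x₂ + x₃ * x₃ := Real.sq_sqrt h.le
  refine ⟨Real.sqrt (x₁ * x₁ + x₂ * x₂ + x₃ * x₃), x₁ / Real.sqrt (x₁ * x₁ + x₂ * x₂ + x₃ * x₃), x₂ / Real.sqrt (x₁ * x₁ + x₂ * x₂ + x₃ * x₃),
    x₃ / Real.sqrt (x₁ * x₁ + x₂ * x₂ + x₃ * x₃), Real.sqrt_pos.2 h, hr, ?_, ?_, ?_, ?_⟩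
  · rw [mul_div_assoc', mul_comm, mul_div_assoc, div_self hs, mul_one]
  · rw [mul_div_assoc', mul_comm, mul_div_assoc, div_self hs, mul_one]
  · rw [mul_div_assoc', mul_comm, mul_div_assoc, div_self hs, mul_one]
  · rw [div_pow, div_pow, div_pow, ← add_div, ← add_div, hr, div_eq_one_iff_eq h.ne']
    ring

set_option maxHeartbeats 1600000 in
-- one long construction with many intermediate real-arithmetic facts
/-- ★ **LINEAR stability of the twisted commutation relations.**  Let `a, u₀, u₁, u₂` be unit quaternions, `ε : Fin 3 → Bool` with `ε k₀ = true`, and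
`η ≥ 0` with `‖u_i u_j − u_j u_i‖ ≤ η` for all `i, j`, `‖a u_k + u_k a‖ ≤ η` for `ε k = true` and `‖a u_k − u_k a‖ ≤ η` for `ε k = false`.  Then there are unit
quaternions `a', u'_k` with `u'_i u'_j = u'_j u'_i`, `a' u'_k = −u'_k a'` (`ε k = true`), `a' u'_k = u'_k a'` (`ε k = false`), and `‖a − a'‖ ≤ 4η`,
`‖u_k − u'_k‖ ≤ 4η`.  (The relations are rigid: the witness is `a' = (0, n_c)`, `u'_k = (0, ±n₀)` resp. `±1`, with `n₀` the axis of `u_{k₀}` and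
`n_c ⊥ n₀` the normalised projection of `Im a`.) [folklore] -/
theorem exists_twisted_solution_near (a : ℍ) (u : Fin 3 → ℍ) (ε : Fin 3 → Bool) (k₀ : Fin 3) (hk₀ : ε k₀ = true) {η : ℝ} (hη : 0 ≤ η)
    (ha : ‖a‖ = 1) (hu : ∀ k, ‖u k‖ = 1) (hcomm : ∀ i j, ‖u i * u j - u j * u i‖ ≤ η)
    (htw : ∀ k, ε k = true → ‖a * u k + u k * a‖ ≤ η) (hun : ∀ k, ε k = false → ‖a * u k - u k * a‖ ≤ η) :
    ∃ (a' : ℍ) (u' : Fin 3 → ℍ), ‖a'‖ = 1 ∧ (∀ k, ‖u' k‖ = 1) ∧ (∀ i j, u' i * u' j = u' j * u' i) ∧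
      (∀ k, ε k = true → a' * u' k = -(u' k * a')) ∧ (∀ k, ε k = false → a' * u' k = u' k * a') ∧
      ‖a - a'‖ ≤ 4 * η ∧ ∀ k, ‖u k - u' k‖ ≤ 4 * η := by
  -- squared-distance criterion
  have key : ∀ x y : ℍ, ‖x - y‖ ^ 2 ≤ 16 * η ^ 2 → ‖x - y‖ ≤ 4 * η := fun x y h => by
    have h0 : 0 ≤ ‖x - y‖ := norm_nonneg _
    nlinarith [h0, hη]
  by_cases hη2 : η ≤ 1 / 2
  swap
  · -- large `η`: any exact solution will do
    push Not at hη2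
    let a' : ℍ := ⟨0, 1, 0, 0⟩
    let u' : Fin 3 → ℍ := fun k => if ε k then ⟨0, 0, 1, 0⟩ else ⟨1, 0, 0, 0⟩
    have hu'1 : ∀ k, ε k = true → u' k = ⟨0, 0, 1, 0⟩ := fun k hk => by simp [u', hk]
    have hu'0 : ∀ k, ε k = false → u' k = ⟨1, 0, 0, 0⟩ := fun k hk => by simp [u', hk]
    have htri : ∀ x y : ℍ, ‖x‖ = 1 → ‖y‖ = 1 → ‖x - y‖ ≤ 4 * η := fun x y hx hy => by
      calc ‖x - y‖ ≤ ‖x‖ + ‖y‖ := norm_sub_le _ _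
        _ = 2 := by rw [hx, hy]; norm_num
        _ ≤ 4 * η := by linarith
    have hn1 : ‖(a' : ℍ)‖ = 1 := norm_eq_one_of_components (by simp [a'])
    have hn2 : ∀ k, ‖u' k‖ = 1 := fun k => by
      cases hk : ε k
      · rw [hu'0 k hk]; exact norm_eq_one_of_components (by simp)
      · rw [hu'1 k hk]; exact norm_eq_one_of_components (by simp)
    refine ⟨a', u', hn1, hn2, fun i j => ?_, fun k hk => ?_, fun k hk => ?_, htri _ _ ha hn1, fun k => htri _ _ (hu k) (hn2 k)⟩
    · -- all `u' k` have imaginary part along `(0,1,0)`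
      have hpar : ∀ k, (u' k).imI = (if ε k then (1:ℝ) else 0) * 0 ∧ (u' k).imJ = (if ε k then (1:ℝ) else 0) * 1 ∧ (u' k).imK = (if ε k then (1:ℝ) else 0) * 0 := by
        intro k; cases hk : ε k
        · rw [hu'0 k hk]; simp
        · rw [hu'1 k hk]; simp
      exact mul_comm_of_parallel (hpar i).1 (hpar i).2.1 (hpar i).2.2 (hpar j).1 (hpar j).2.1 (hpar j).2.2
    · rw [hu'1 k hk]; exact pure_mul_pure_eq_neg rfl rfl (by simp [a'])
    · rw [hu'0 k hk]; exact (mul_comm_of_im_zero a' (x := ⟨1, 0, 0, 0⟩) rfl rfl rfl).symm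
  -- small `η`: the construction
  have hη4 : η ^ 2 ≤ 1 / 4 := by nlinarith only [hη, hη2]
  have hunit : ∀ x : ℍ, ‖x‖ = 1 → x.re ^ 2 + (x.imI * x.imI + x.imJ * x.imJ + x.imK * x.imK) = 1 := fun x hx => by
    rw [← norm_sq_eq_re_sq_add_imDot, hx, one_pow]
  obtain ⟨hsa, hs0, hd0⟩ := sq_le_of_anticomm ha (hu k₀) (htw k₀ hk₀)
  have hua := hunit a ha
  have huu0 := hunit (u k₀) (hu k₀)
  -- the axis `n₀` of the twisted pivot: `Im u_{k₀} = r0 · n`, `r0² = |Im u_{k₀}|² ≥ 15/16`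
  have hm0ge : 15 / 16 ≤ (u k₀).imI * (u k₀).imI + (u k₀).imJ * (u k₀).imJ + (u k₀).imK * (u k₀).imK := by linarith
  obtain ⟨r0, n₁, n₂, n₃, hr0pos, hr02, e01, e02, e03, hn⟩ := exists_unit_of_pos (by linarith : 0 < (u k₀).imI * (u k₀).imI + (u k₀).imJ * (u k₀).imJ + (u k₀).imK * (u k₀).imK)
  -- the projection coefficient `t = Im a · n₀` and the perpendicular part `p = Im a − t n₀`
  obtain ⟨t, ht⟩ : ∃ t : ℝ, t = a.imI * n₁ + a.imJ * n₂ + a.imK * n₃ := ⟨_, rfl⟩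
  have htd : r0 * t = a.imI * (u k₀).imI + a.imJ * (u k₀).imJ + a.imK * (u k₀).imK := by rw [ht, e01, e02, e03]; ring
  have ht2 : t ^ 2 ≤ η ^ 2 / 3 := by
    have h1 : r0 ^ 2 * t ^ 2 ≤ η ^ 2 / 4 := by rw [← mul_pow, htd]; exact hd0
    rw [hr02] at h1
    nlinarith only [h1, hm0ge, sq_nonneg t, sq_nonneg η]
  obtain ⟨p₁, hp₁⟩ : ∃ p : ℝ, p = a.imI - t * n₁ := ⟨_, rfl⟩
  obtain ⟨p₂, hp₂⟩ : ∃ p : ℝ, p = a.imJ - t * n₂ := ⟨_, rfl⟩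
  obtain ⟨p₃, hp₃⟩ : ∃ p : ℝ, p = a.imK - t * n₃ := ⟨_, rfl⟩
  have hpn : p₁ * n₁ + p₂ * n₂ + p₃ * n₃ = 0 := by
    rw [hp₁, hp₂, hp₃]; linear_combination -1 * ht - t * hn
  have hPeq : p₁ * p₁ + p₂ * p₂ + p₃ * p₃ = (a.imI * a.imI + a.imJ * a.imJ + a.imK * a.imK) - t ^ 2 := by
    rw [hp₁, hp₂, hp₃]; linear_combination 2 * t * ht + t ^ 2 * hn
  have hPge : 41 / 48 ≤ p₁ * p₁ + p₂ * p₂ + p₃ * p₃ := by rw [hPeq]; linarith [hua, hsa, ht2, hη4]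
  have hPle : p₁ * p₁ + p₂ * p₂ + p₃ * p₃ ≤ 1 := by rw [hPeq]; nlinarith only [hua, sq_nonneg a.re, sq_nonneg t]
  obtain ⟨rp, c₁, c₂, c₃, hrppos, hrp2, ec1, ec2, ec3, hc⟩ := exists_unit_of_pos (by linarith : 0 < p₁ * p₁ + p₂ * p₂ + p₃ * p₃)
  have hcn : c₁ * n₁ + c₂ * n₂ + c₃ * n₃ = 0 := by
    have : rp * (c₁ * n₁ + c₂ * n₂ + c₃ * n₃) = rp * 0 := by rw [mul_zero, ← hpn, ec1, ec2, ec3]; ring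
    exact mul_left_cancel₀ hrppos.ne' this
  have hc' : c₁ * c₁ + c₂ * c₂ + c₃ * c₃ = 1 := by linarith [hc]
  -- the witnesses
  let a' : ℍ := ⟨0, c₁, c₂, c₃⟩
  let σ : Fin 3 → ℝ := fun k => if 0 ≤ (u k).imI * n₁ + (u k).imJ * n₂ + (u k).imK * n₃ then 1 else -1
  let σ' : Fin 3 → ℝ := fun k => if 0 ≤ (u k).re then 1 else -1
  let u' : Fin 3 → ℍ := fun k => if ε k then ⟨0, σ k * n₁, σ k * n₂, σ k * n₃⟩ else ⟨σ' k, 0, 0, 0⟩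
  have hσsq : ∀ k, σ k ^ 2 = 1 := fun k => by simp only [σ]; split_ifs <;> norm_num
  have hσ'sq : ∀ k, σ' k ^ 2 = 1 := fun k => by simp only [σ']; split_ifs <;> norm_num
  have hu'1 : ∀ k, ε k = true → u' k = ⟨0, σ k * n₁, σ k * n₂, σ k * n₃⟩ := fun k hk => by simp only [u', hk, if_true]
  have hu'0 : ∀ k, ε k = false → u' k = ⟨σ' k, 0, 0, 0⟩ := fun k hk => by simp only [u', hk]; simp
  have ha'n : ‖a'‖ = 1 := norm_eq_one_of_components (by show (0:ℝ) ^ 2 + (c₁ * c₁ + c₂ * c₂ + c₃ * c₃) = 1; linarith [hc'])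
  have hu'n : ∀ k, ‖u' k‖ = 1 := fun k => by
    cases hk : ε k
    · rw [hu'0 k hk]; exact norm_eq_one_of_components (by show σ' k ^ 2 + (0 * 0 + 0 * 0 + (0:ℝ) * 0) = 1; linarith [hσ'sq k])
    · rw [hu'1 k hk]
      exact norm_eq_one_of_components (by
        show (0:ℝ) ^ 2 + (σ k * n₁ * (σ k * n₁) + σ k * n₂ * (σ k * n₂) + σ k * n₃ * (σ k * n₃)) = 1
        linear_combination (σ k) ^ 2 * hn + hσsq k)
  have hpar : ∀ k, (u' k).imI = (if ε k then σ k else 0) * n₁ ∧ (u' k).imJ = (if ε k then σ k else 0) * n₂ ∧ (u' k).imK = (if ε k then σ k else 0) * n₃ := by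
    intro k; cases hk : ε k
    · rw [hu'0 k hk]; simp
    · rw [hu'1 k hk]; simp
  refine ⟨a', u', ha'n, hu'n, fun i j => mul_comm_of_parallel (hpar i).1 (hpar i).2.1 (hpar i).2.2 (hpar j).1 (hpar j).2.1 (hpar j).2.2,
    fun k hk => ?_, fun k hk => ?_, key _ _ ?_, fun k => key _ _ ?_⟩
  · -- twisted relation: pure imaginary with orthogonal imaginary parts
    rw [hu'1 k hk]
    exact pure_mul_pure_eq_neg rfl rfl (by show c₁ * (σ k * n₁) + c₂ * (σ k * n₂) + c₃ * (σ k * n₃) = 0; linear_combination σ k * hcn)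
  · -- untwisted relation: real quaternions are central
    rw [hu'0 k hk]; exact (mul_comm_of_im_zero a' (x := ⟨σ' k, 0, 0, 0⟩) rfl rfl rfl).symm
  · -- ‖a − a'‖² = s_a² + t² + (rp − 1)² ≤ 16η²
    have h1 : a.imI = t * n₁ + rp * c₁ := by rw [← ec1, hp₁]; ring
    have h2 : a.imJ = t * n₂ + rp * c₂ := by rw [← ec2, hp₂]; ring
    have h3 : a.imK = t * n₃ + rp * c₃ := by rw [← ec3, hp₃]; ring
    have e : ‖a - a'‖ ^ 2 = a.re ^ 2 + (t ^ 2 + (rp - 1) ^ 2) := by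
      rw [norm_sq_eq_re_sq_add_imDot]
      have er : (a - a').re = a.re := by show a.re - 0 = a.re; ring
      have e1 : (a - a').imI = t * n₁ + (rp - 1) * c₁ := by show a.imI - c₁ = _; rw [h1]; ring
      have e2 : (a - a').imJ = t * n₂ + (rp - 1) * c₂ := by show a.imJ - c₂ = _; rw [h2]; ring
      have e3 : (a - a').imK = t * n₃ + (rp - 1) * c₃ := by show a.imK - c₃ = _; rw [h3]; ring
      rw [er, e1, e2, e3]
      linear_combination (t ^ 2) * hn + (rp - 1) ^ 2 * hc' + 2 * t * (rp - 1) * hcn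
    have hrp1 : (rp - 1) ^ 2 ≤ (1 - (p₁ * p₁ + p₂ * p₂ + p₃ * p₃)) ^ 2 := by
      have h0 : (1 : ℝ) ≤ (rp + 1) ^ 2 := by nlinarith only [hrppos, sq_nonneg rp]
      have hA : (rp - 1) ^ 2 * 1 ≤ (rp - 1) ^ 2 * (rp + 1) ^ 2 := mul_le_mul_of_nonneg_left h0 (sq_nonneg _)
      have hB : (rp - 1) ^ 2 * (rp + 1) ^ 2 = (1 - (p₁ * p₁ + p₂ * p₂ + p₃ * p₃)) ^ 2 := by rw [← hrp2]; ring
      linarith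
    have h1P : 1 - (p₁ * p₁ + p₂ * p₂ + p₃ * p₃) ≤ 7 * η ^ 2 / 12 := by rw [hPeq]; linarith [hua, hsa, ht2]
    have h1P0 : 0 ≤ 1 - (p₁ * p₁ + p₂ * p₂ + p₃ * p₃) := by linarith
    have h1Psq : (1 - (p₁ * p₁ + p₂ * p₂ + p₃ * p₃)) ^ 2 ≤ (7 * η ^ 2 / 12) ^ 2 := pow_le_pow_left₀ h1P0 h1P 2
    have hq : (7 * η ^ 2 / 12) ^ 2 ≤ η ^ 2 := by
      have h4 : η ^ 2 * η ^ 2 ≤ η ^ 2 * (1 / 4) := mul_le_mul_of_nonneg_left hη4 (sq_nonneg η)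
      nlinarith only [h4, sq_nonneg η]
    rw [e]
    linarith only [h1Psq, hrp1, hsa, ht2, hq, sq_nonneg η]
  · -- the members
    have huk := hunit (u k) (hu k)
    obtain ⟨τ, hτ⟩ : ∃ τ : ℝ, τ = (u k).imI * n₁ + (u k).imJ * n₂ + (u k).imK * n₃ := ⟨_, rfl⟩
    -- the component of `Im u_k` perpendicular to `n₀` is small (commutation with the pivot)
    have hcross := cross_sq_le_of_comm (u k) (u k₀) (hcomm k k₀)
    have hperp : ((u k).imI * (u k).imI + (u k).imJ * (u k).imJ + (u k).imK * (u k).imK) - τ ^ 2 ≤ 4 * η ^ 2 / 15 := by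
      -- `r0²·(D_k − τ²) = |v_k|²|v0|² − (v_k·v0)²`
      have e1 : r0 ^ 2 * (((u k).imI * (u k).imI + (u k).imJ * (u k).imJ + (u k).imK * (u k).imK) - τ ^ 2) =
          ((u k).imI * (u k).imI + (u k).imJ * (u k).imJ + (u k).imK * (u k).imK) *
            ((u k₀).imI * (u k₀).imI + (u k₀).imJ * (u k₀).imJ + (u k₀).imK * (u k₀).imK) -
          ((u k).imI * (u k₀).imI + (u k).imJ * (u k₀).imJ + (u k).imK * (u k₀).imK) ^ 2 := by
        rw [hτ, e01, e02, e03]; linear_combination (-(r0 ^ 2) * ((u k).imI * (u k).imI + (u k).imJ * (u k).imJ + (u k).imK * (u k).imK)) * hn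
      have h2 : r0 ^ 2 * (((u k).imI * (u k).imI + (u k).imJ * (u k).imJ + (u k).imK * (u k).imK) - τ ^ 2) ≤ η ^ 2 / 4 := by rw [e1]; exact hcross
      rw [hr02] at h2
      by_contra hcon
      push Not at hcon
      nlinarith only [hm0ge, hcon, h2, sq_nonneg η]
    have hτD : τ ^ 2 ≤ (u k).imI * (u k).imI + (u k).imJ * (u k).imJ + (u k).imK * (u k).imK := by
      have hl := lagrange₃ (u k).imI (u k).imJ (u k).imK n₁ n₂ n₃
      have hn' : n₁ * n₁ + n₂ * n₂ + n₃ * n₃ = 1 := by linarith [hn]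
      rw [hn', mul_one, ← hτ] at hl
      nlinarith only [hl, sq_nonneg ((u k).imJ * n₃ - (u k).imK * n₂), sq_nonneg ((u k).imK * n₁ - (u k).imI * n₃), sq_nonneg ((u k).imI * n₂ - (u k).imJ * n₁)]
    cases hk : ε k
    · -- untwisted member: `Im u_k` is small
      rw [hu'0 k hk]
      have hC := cross_sq_le_of_comm a (u k) (hun k hk)
      obtain ⟨r₁, hr₁⟩ : ∃ r : ℝ, r = (u k).imI - τ * n₁ := ⟨_, rfl⟩
      obtain ⟨r₂, hr₂⟩ : ∃ r : ℝ, r = (u k).imJ - τ * n₂ := ⟨_, rfl⟩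
      obtain ⟨r₃, hr₃⟩ : ∃ r : ℝ, r = (u k).imK - τ * n₃ := ⟨_, rfl⟩
      have Da1 : (a.imI * a.imI + a.imJ * a.imJ + a.imK * a.imK) ≤ 1 := by nlinarith only [hua, sq_nonneg a.re]
      -- |v_a × v_k|² ≤ η²/4
      have hCk : (a.imJ * (u k).imK - a.imK * (u k).imJ) ^ 2 + (a.imK * (u k).imI - a.imI * (u k).imK) ^ 2 + (a.imI * (u k).imJ - a.imJ * (u k).imI) ^ 2 ≤ η ^ 2 / 4 := by
        rw [← lagrange₃]; exact hC
      -- |v_a × n0|² = |v_a|² − t² = P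
      have hEn : (a.imJ * n₃ - a.imK * n₂) ^ 2 + (a.imK * n₁ - a.imI * n₃) ^ 2 + (a.imI * n₂ - a.imJ * n₁) ^ 2 = p₁ * p₁ + p₂ * p₂ + p₃ * p₃ := by
        have hl := lagrange₃ a.imI a.imJ a.imK n₁ n₂ n₃
        have hn' : n₁ * n₁ + n₂ * n₂ + n₃ * n₃ = 1 := by linarith [hn]
        rw [hn', mul_one, ← ht] at hl
        linarith [hPeq]
      -- |v_a × r|² ≤ |v_a|²·|r|² ≤ R = D_k − τ²
      have hR : r₁ * r₁ + r₂ * r₂ + r₃ * r₃ = ((u k).imI * (u k).imI + (u k).imJ * (u k).imJ + (u k).imK * (u k).imK) - τ ^ 2 := by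
        rw [hr₁, hr₂, hr₃]; linear_combination 2 * τ * hτ + τ ^ 2 * hn
      have hR0 : 0 ≤ r₁ * r₁ + r₂ * r₂ + r₃ * r₃ := add_nonneg (add_nonneg (mul_self_nonneg _) (mul_self_nonneg _)) (mul_self_nonneg _)
      have hGr : (a.imJ * r₃ - a.imK * r₂) ^ 2 + (a.imK * r₁ - a.imI * r₃) ^ 2 + (a.imI * r₂ - a.imJ * r₁) ^ 2 ≤ 4 * η ^ 2 / 15 := by
        rw [← lagrange₃]
        have := mul_le_mul_of_nonneg_right Da1 hR0
        nlinarith only [this, hperp, hR, sq_nonneg (a.imI * r₁ + a.imJ * r₂ + a.imK * r₃)]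
      -- τ·(v_a × n0) = (v_a × v_k) − (v_a × r) componentwise
      have id1 : τ * (a.imJ * n₃ - a.imK * n₂) = (a.imJ * (u k).imK - a.imK * (u k).imJ) - (a.imJ * r₃ - a.imK * r₂) := by rw [hr₂, hr₃]; ring
      have id2 : τ * (a.imK * n₁ - a.imI * n₃) = (a.imK * (u k).imI - a.imI * (u k).imK) - (a.imK * r₁ - a.imI * r₃) := by rw [hr₁, hr₃]; ring
      have id3 : τ * (a.imI * n₂ - a.imJ * n₁) = (a.imI * (u k).imJ - a.imJ * (u k).imI) - (a.imI * r₂ - a.imJ * r₁) := by rw [hr₁, hr₂]; ring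
      have hτb : τ ^ 2 * (p₁ * p₁ + p₂ * p₂ + p₃ * p₃) ≤ 2 * (η ^ 2 / 4) + 2 * (4 * η ^ 2 / 15) := by
        have hsum : τ ^ 2 * (p₁ * p₁ + p₂ * p₂ + p₃ * p₃) =
            (τ * (a.imJ * n₃ - a.imK * n₂)) ^ 2 + (τ * (a.imK * n₁ - a.imI * n₃)) ^ 2 + (τ * (a.imI * n₂ - a.imJ * n₁)) ^ 2 := by
          rw [← hEn]; ring
        rw [hsum, id1, id2, id3]
        nlinarith only [hCk, hGr, sq_nonneg ((a.imJ * (u k).imK - a.imK * (u k).imJ) + (a.imJ * r₃ - a.imK * r₂)),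
          sq_nonneg ((a.imK * (u k).imI - a.imI * (u k).imK) + (a.imK * r₁ - a.imI * r₃)),
          sq_nonneg ((a.imI * (u k).imJ - a.imJ * (u k).imI) + (a.imI * r₂ - a.imJ * r₁))]
      have hτ2 : τ ^ 2 ≤ 3 * η ^ 2 / 2 := by nlinarith only [hτb, hPge, sq_nonneg τ, sq_nonneg η]
      have hDk2 : (u k).imI * (u k).imI + (u k).imJ * (u k).imJ + (u k).imK * (u k).imK ≤ 2 * η ^ 2 := by linarith
      have e : ‖u k - ⟨σ' k, 0, 0, 0⟩‖ ^ 2 = ((u k).re - σ' k) ^ 2 + ((u k).imI * (u k).imI + (u k).imJ * (u k).imJ + (u k).imK * (u k).imK) := by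
        rw [norm_sq_eq_re_sq_add_imDot]
        have er : (u k - ⟨σ' k, 0, 0, 0⟩).re = (u k).re - σ' k := rfl
        have e1 : (u k - ⟨σ' k, 0, 0, 0⟩).imI = (u k).imI := by show (u k).imI - 0 = _; ring
        have e2 : (u k - ⟨σ' k, 0, 0, 0⟩).imJ = (u k).imJ := by show (u k).imJ - 0 = _; ring
        have e3 : (u k - ⟨σ' k, 0, 0, 0⟩).imK = (u k).imK := by show (u k).imK - 0 = _; ring
        rw [er, e1, e2, e3]
      rw [e]
      have := untwisted_member_arith (s := (u k).re) (D := (u k).imI * (u k).imI + (u k).imJ * (u k).imJ + (u k).imK * (u k).imK) huk (imDot_self_nonneg (u k))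
      simp only [σ']
      linarith
    · -- twisted member: `Im u_k ≈ ±n₀`, real part small
      rw [hu'1 k hk]
      obtain ⟨-, hsk2, -⟩ := sq_le_of_anticomm ha (hu k) (htw k hk)
      have hστ : σ k * τ = |τ| := by
        simp only [σ]; rw [← hτ]; split_ifs with h
        · rw [abs_of_nonneg h, one_mul]
        · rw [abs_of_neg (lt_of_not_ge h)]; ring
      have e : ‖u k - ⟨0, σ k * n₁, σ k * n₂, σ k * n₃⟩‖ ^ 2 = 2 - 2 * |τ| := by
        rw [norm_sq_eq_re_sq_add_imDot]
        have er : (u k - ⟨0, σ k * n₁, σ k * n₂, σ k * n₃⟩).re = (u k).re := by show (u k).re - 0 = _; ring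
        have e1 : (u k - ⟨0, σ k * n₁, σ k * n₂, σ k * n₃⟩).imI = (u k).imI - σ k * n₁ := rfl
        have e2 : (u k - ⟨0, σ k * n₁, σ k * n₂, σ k * n₃⟩).imJ = (u k).imJ - σ k * n₂ := rfl
        have e3 : (u k - ⟨0, σ k * n₁, σ k * n₂, σ k * n₃⟩).imK = (u k).imK - σ k * n₃ := rfl
        rw [er, e1, e2, e3]
        have hτ' : σ k * ((u k).imI * n₁ + (u k).imJ * n₂ + (u k).imK * n₃) = |τ| := by rw [← hτ]; exact hστ
        linear_combination huk + (σ k) ^ 2 * hn - 2 * hτ' + hσsq k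
      rw [e]
      exact twisted_member_arith hsk2 huk hperp hτD

end Summit.QuantumFields.YangMills.Theorems.TwistEaterVolume.Quadratic

end
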